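import Literature.AnabelianGeometry.EtaleTheta.Discharge.Sec5ModelCaseBase
import Literature.AlgebraicGeometry.Frobenioids.BaseEquivalencePreserved

/-!
# [EtTh] §5 for a MODEL tempered Frobenioid, III: base-equivalence preservation ([FrdI] Thm. 3.4 (v), first sentence) from layer L1 — no [FrdI] binder left (pp. 320, 329 / PDF pp. 94, 103)

Mochizuki, *The étale theta function …*, Publ. RIMS **45** (2009)
[cite: MochizukiEtTh2009, Thm 5.7 p.329–330 (PDF pp.103–104)]; *The geometry of Frobenioids I*, Kyushu J. Math.
**62** (2008) [cite: MochizukiFrdI2008, Thm. 3.4 (v) p.63].  Seat abc-iut-L2-d4 (sequel to `Sec5ModelCase.lean`,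
`Sec5ModelCaseBase.lean`); PROOF-ONLY.

The last [FrdI] binder of the §5 model case — "`Ψ` (and `Ψ⁻¹`) preserve base-equivalent pairs" (proof of [EtTh]
Thm. 5.6, p.329: "`Ψ` maps this pair of base-equivalent pre-steps to a pair of base-equivalent pre-steps"; [FrdI]
Thm. 3.4 (v), first sentence) — is abc-iut-L1-d4's `PreFrobenioid.baseEquivalent_map_of_isSlim`
(`BaseEquivalencePreserved.lean`, L1 sub-node L12b: slim base + "`Ψ` preserves base-isomorphisms", the latter =
[FrdI] Thm. 3.4 (iii), abc-iut-L1-t13's `FrdI.thm34iii_morphisms_of_isOfFSMType` for the model).  [EtTh]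
Rmk. 3.7.2 / proof of Thm. 4.4 (p.320): "the base category `D_i` of `C_i` is slim".  Hence, for §5 data over a
MODEL tempered Frobenioid ([EtTh] Def. 3.6 (ii)) over a slim base of FSM-type with `Φ` non-dilating and `C` not of
group-like type ([EtTh] Thm. 3.7 (i)(ii), Prop. 5.1): Theorem 5.7 at the `N`-th root holds MODULO ONLY
Prop. 5.3 (vi) read at `A_N` and Thm. 5.7's own rigidity clause (`rootTransport_of_model_slim`); Theorem 5.10
(ii)(iii) and Theorem 5.6 follow from the §5 `Facts`, the birational/constant inputs, Prop. 5.3 (vi) at `A_N`, the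
rigidity clause and the anabelian transport data ALONE (`thm510_ii_iii_of_model_slim`,
`cyclotomicRigidityPreserved_of_model_slim`) — every [FrdI] category-theoretic input of the §5 side of the
mono-theta chain is a theorem of layer L1.  HONEST FRAMING: kernel-checked implications; nothing asserts that
the §5 data exist for an actual curve; typed ≠ discharged; no side is taken on anything downstream. -/

set_option backward.isDefEq.respectTransparency false

namespace Literature.AnabelianGeometry.EtaleTheta

open CategoryTheory Opposite
open Literature.AlgebraicGeometry.Frobenioids

universe w v u

namespace ThetaFrobenioid

variable {D : Type u} [Category.{v} D] {Φ B : Dᵒᵖ ⥤ CommMonCat.{w}} {DivB : B ⟶ monoidGp Φ}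
  {𝔉 : ThetaFrobenioid.{w} (ModelFrobenioid Φ B DivB) D}

/-- **"`Ψ` preserves base-equivalent pairs" for the model** ([FrdI] Thm. 3.4 (v), first sentence; the binder `hbe`
of `Sec5Thm57.exists_codTransport_of_div_eq`): for a slim base of FSM-type, `Φ` non-dilating, `C` not of
group-like type — abc-iut-L1-d4's `PreFrobenioid.baseEquivalent_map_of_isSlim` fed with [FrdI] Thm. 3.4 (iii)'s
preservation of base-isomorphisms (abc-iut-L1-t13's `FrdI.thm34iii_morphisms_of_isOfFSMType`).
[cite: MochizukiFrdI2008, Thm. 3.4 (v) p.63] -/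
theorem baseEquivalent_map_of_model (h𝔉 : 𝔉.pre = PreFrobenioidData.ofModel Φ B DivB)
    (h : ModelFrobenioid.Hypotheses Φ B) (hD : IsOfFSMType D) (hslim : IsSlim D) (hnd : IsNonDilatingOn Φ)
    (hN : ∃ A : ModelFrobenioid Φ B DivB, ¬ (PreFrobenioidData.ofModel Φ B DivB).IsGroupLikeObj A)
    (Ψ : ModelFrobenioid Φ B DivB ≌ ModelFrobenioid Φ B DivB) :
    ∀ ⦃A X : ModelFrobenioid Φ B DivB⦄ (φ ψ : A ⟶ X), 𝔉.pre.BaseEquivalent φ ψ →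
      𝔉.pre.BaseEquivalent (Ψ.functor.map φ) (Ψ.functor.map ψ) := by
  rw [h𝔉]
  intro A X φ ψ hφψ
  have hF := ModelFrobenioid.isFrobenioid (DivB := DivB) h.isMonoidOn h.isDivisorial h.isMonoidOn_rat
    h.isGroupLike_rat h.isGraphConnected h.isTotallyEpimorphic
  have hq := ModelFrobenioid.data_isOfQuasiIsotropicType (DivB := DivB) h
  have hnd' : (ModelFrobenioid.data Φ B DivB).IsNonDilatingOn :=
    (ModelFrobenioid.data_isNonDilatingOn_iff Φ B DivB).mpr hnd
  have hbiso : ∀ ⦃X Y : ModelFrobenioid Φ B DivB⦄ (f : X ⟶ Y),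
      IsIso (PreFrobenioid.Base (ModelFrobenioid.toElem Φ B DivB) f) →
      IsIso (PreFrobenioid.Base (ModelFrobenioid.toElem Φ B DivB) (Ψ.functor.map f)) :=
    fun X Y f hf => (FrdI.thm34iii_morphisms_of_isOfFSMType hF hF hq hq hD hD hnd' hnd' Ψ hN hN).1.2.2.1 f hf
  exact PreFrobenioid.baseEquivalent_map_of_isSlim hF hF Ψ hslim hbiso hφψ

section Slim

variable (Ψ : ModelFrobenioid Φ B DivB ≌ ModelFrobenioid Φ B DivB)
  (α : Ψ.functor.obj 𝔉.AN ≅ 𝔉.AN) (β : Ψ.functor.obj 𝔉.BN ≅ 𝔉.BN)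

/-- **[EtTh] Thm. 4.4 (i) for the model, no [FrdI] binder**: a faithful `Ψbs : D ⥤ D` with
`Ψ ⋙ Base ≅ Base ⋙ Ψbs`, for every self-equivalence of a model tempered Frobenioid over a slim base of FSM-type
(`Φ` non-dilating, `C` not of group-like type).  [cite: MochizukiEtTh2009, Thm 4.4 (i) p.320 (PDF p.94)] -/
theorem exists_compatBase_of_model_slim (h𝔉 : 𝔉.pre = PreFrobenioidData.ofModel Φ B DivB)
    (h : ModelFrobenioid.Hypotheses Φ B) (hD : IsOfFSMType D) (hslim : IsSlim D) (hnd : IsNonDilatingOn Φ)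
    (hN : ∃ A : ModelFrobenioid Φ B DivB, ¬ (PreFrobenioidData.ofModel Φ B DivB).IsGroupLikeObj A) :
    ∃ (Ψbs : D ⥤ D) (_ : Ψbs.Faithful), Nonempty (Ψ.functor ⋙ 𝔉.base ≅ 𝔉.base ⋙ Ψbs) :=
  exists_compatBase_of_model Ψ h𝔉 h hD (baseEquivalent_map_of_model h𝔉 h hD hslim hnd hN Ψ)
    (baseEquivalent_map_of_model h𝔉 h hD hslim hnd hN Ψ.symm)

/-- **[EtTh] Theorem 5.7 at the `N`-th root, model case, no [FrdI] binder**: `RootTransport Ψ α β` MODULO ONLY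
Prop. 5.3 (vi) read at `A_N` (`hdiv`) and the rigidity clause of Thm. 5.7 read at level `N` (`hrig`).
[cite: MochizukiEtTh2009, Thm 5.7 p.329–330 (PDF pp.103–104)] -/
theorem rootTransport_of_model_slim (h𝔉 : 𝔉.pre = PreFrobenioidData.ofModel Φ B DivB)
    (h : ModelFrobenioid.Hypotheses Φ B) (hD : IsOfFSMType D) (hslim : IsSlim D) (hnd : IsNonDilatingOn Φ)
    (hN : ∃ A : ModelFrobenioid Φ B DivB, ¬ (PreFrobenioidData.ofModel Φ B DivB).IsGroupLikeObj A)
    (hdiv : ∃ e : 𝔉.AN ≅ 𝔉.AN,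
      𝔉.pre.div (α.inv ≫ Ψ.functor.map 𝔉.sCap ≫ β.hom) = 𝔉.pre.div (e.hom ≫ 𝔉.sCap) ∧
      𝔉.pre.div (α.inv ≫ Ψ.functor.map 𝔉.sCup ≫ β.hom) = 𝔉.pre.div (e.hom ≫ 𝔉.sCup))
    (hrig : ∀ (e : 𝔉.AN ≅ 𝔉.AN) (Dc Dp : Aut 𝔉.BN),
      α.inv ≫ Ψ.functor.map 𝔉.sCap ≫ β.hom = e.hom ≫ 𝔉.sCap ≫ Dc.hom →
      α.inv ≫ Ψ.functor.map 𝔉.sCup ≫ β.hom = e.hom ≫ 𝔉.sCup ≫ Dp.hom →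
      Dc⁻¹ * Dp ∈ 𝔉.units 𝔉.BN → Dc⁻¹ * Dp ∈ 𝔉.muTorsion 𝔉.BN (2 * 𝔉.l * 𝔉.N) ⊓ 𝔉.OKxRootN) :
    𝔉.RootTransport Ψ α β :=
  rootTransport_of_model Ψ α β h𝔉 h hD (baseEquivalent_map_of_model h𝔉 h hD hslim hnd hN Ψ) hdiv hrig

/-- **[EtTh] Theorem 5.10 (ii)(iii), model case, END-TO-END, no [FrdI] binder.**
[cite: MochizukiEtTh2009, Thm 5.10 (ii)(iii) p.333–335 (PDF pp.107–109)] -/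
theorem thm510_ii_iii_of_model_slim (h𝔉 : 𝔉.pre = PreFrobenioidData.ofModel Φ B DivB)
    (h : ModelFrobenioid.Hypotheses Φ B) (hD : IsOfFSMType D) (hslim : IsSlim D) (hnd : IsNonDilatingOn Φ)
    (hN : ∃ A : ModelFrobenioid Φ B DivB, ¬ (PreFrobenioidData.ofModel Φ B DivB).IsGroupLikeObj A)
    (H : 𝔉.Facts) (ΨbiratAut : 𝔉.biratUnits 𝔉.BN ≃* 𝔉.biratUnits 𝔉.BN)
    (hsq : ∀ u : 𝔉.units 𝔉.BN, ∀ hu : 𝔉.psiAut Ψ β u ∈ 𝔉.units 𝔉.BN,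
      ΨbiratAut (𝔉.unitsToBirat 𝔉.BN u) = 𝔉.unitsToBirat 𝔉.BN ⟨_, hu⟩)
    (hconst : 𝔉.constEmb.range.map ΨbiratAut.toMonoidHom = 𝔉.constEmb.range)
    (e : 𝔉.AN ≅ 𝔉.AN)
    (hcap : 𝔉.pre.div (α.inv ≫ Ψ.functor.map 𝔉.sCap ≫ β.hom) = 𝔉.pre.div (e.hom ≫ 𝔉.sCap))
    (hcup : 𝔉.pre.div (α.inv ≫ Ψ.functor.map 𝔉.sCup ≫ β.hom) = 𝔉.pre.div (e.hom ≫ 𝔉.sCup))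
    (hζ : ∀ Dc Dp : Aut 𝔉.BN,
      α.inv ≫ Ψ.functor.map 𝔉.sCap ≫ β.hom = e.hom ≫ 𝔉.sCap ≫ Dc.hom →
      α.inv ≫ Ψ.functor.map 𝔉.sCup ≫ β.hom = e.hom ≫ 𝔉.sCup ≫ Dp.hom →
      ∀ hu : Dc⁻¹ * Dp ∈ 𝔉.units 𝔉.BN, ∃ ζ : 𝔉.Kˣ, ζ ^ (2 * 𝔉.l) = 1 ∧
        𝔉.unitsToBirat 𝔉.BN ⟨Dc⁻¹ * Dp, hu⟩ ^ (𝔉.N : ℕ) = 𝔉.constEmb ζ)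
    (θ : Aut (𝔉.base.obj 𝔉.BN) ≃* Aut (𝔉.base.obj 𝔉.BN))
    (hstrv : ∀ g : Aut (𝔉.base.obj 𝔉.BN),
      α.inv ≫ Ψ.functor.map (𝔉.strv (𝔉.autBaseIsoAB.symm g)).hom ≫ α.hom ≫ e.hom =
        e.hom ≫ (𝔉.strv (𝔉.autBaseIsoAB.symm (θ g))).hom)
    (hY : 𝔉.imPiY.map θ.toMonoidHom = 𝔉.imPiY) (hYdd : 𝔉.HB.map θ.toMonoidHom = 𝔉.HB)
    (ψY : 𝔉.PiX ≃ₜ* 𝔉.PiX)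
    (hbase : ∀ g, 𝔉.autBase 𝔉.BN (𝔉.psiAut Ψ β (𝔉.sgpCap (𝔉.ρ g))) = 𝔉.ρ (ψY g))
    (hψY : 𝔉.PiY.map ψY.toMulEquiv.toMonoidHom = 𝔉.PiY)
    (hψYdd : 𝔉.PiYdd.map ψY.toMulEquiv.toMonoidHom = 𝔉.PiYdd) :
    𝔉.PsiAutPreserves Ψ β ΨbiratAut ∧
      𝔉.MonoThetaEnvCompat H.sectionsFactor 𝔉.outerActionLZ_of H.sgpCapSection H.sgpCupSection
        H.constantsEqNormalizer ∅ Ψ β ψY hbase hψY hψYdd :=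
  thm510_ii_iii_of_model' Ψ α β h𝔉 h hD H ΨbiratAut (baseEquivalent_map_of_model h𝔉 h hD hslim hnd hN Ψ)
    (baseEquivalent_map_of_model h𝔉 h hD hslim hnd hN Ψ.symm) hsq hconst e hcap hcup hζ θ hstrv hY hYdd ψY
    hbase hψY hψYdd

/-- **[EtTh] Theorem 5.6, model case, no [FrdI] binder.**
[cite: MochizukiEtTh2009, Thm 5.6 p.328–329 (PDF pp.102–103)] -/
theorem cyclotomicRigidityPreserved_of_model_slim (h𝔉 : 𝔉.pre = PreFrobenioidData.ofModel Φ B DivB)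
    (h : ModelFrobenioid.Hypotheses Φ B) (hD : IsOfFSMType D) (hslim : IsSlim D) (hnd : IsNonDilatingOn Φ)
    (hN : ∃ A : ModelFrobenioid Φ B DivB, ¬ (PreFrobenioidData.ofModel Φ B DivB).IsGroupLikeObj A)
    (aΨ : ∀ S : ModelFrobenioid Φ B DivB, 𝔉.lDeltaModN S ≃* 𝔉.lDeltaModN (Ψ.functor.obj S))
    (ρ : FrobenioidCyclotomicRigidity.RigidityFamily 𝔉) (hB : 𝔉.IsThetaSaturated 𝔉.BN)
    (hreach : FrobenioidCyclotomicRigidity.LinearlyReachableFromBN 𝔉)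
    (hρ : FrobenioidCyclotomicRigidity.IsFunctorialLinear 𝔉 ρ)
    (haΨ : ∀ {S T : ModelFrobenioid Φ B DivB} (φ : S ⟶ T) (x : 𝔉.lDeltaModN S),
      aΨ T (𝔉.lDeltaModNMap φ x) = 𝔉.lDeltaModNMap (Ψ.functor.map φ) (aΨ S x))
    (hpull : ∀ {S T : ModelFrobenioid Φ B DivB} (φ : S ⟶ T) (u : 𝔉.muTorsion T 𝔉.N)
      (hu : Ψ.functor.mapAut T (u : Aut T) ∈ 𝔉.muTorsion (Ψ.functor.obj T) 𝔉.N),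
      Ψ.functor.mapAut S (𝔉.muTorsionPull φ 𝔉.N u : Aut S) =
        (𝔉.muTorsionPull (Ψ.functor.map φ) 𝔉.N ⟨_, hu⟩ : Aut (Ψ.functor.obj S)))
    (hBN : ∀ (hΨB : 𝔉.IsThetaSaturated (Ψ.functor.obj 𝔉.BN)) (x : 𝔉.lDeltaModN 𝔉.BN),
      (Ψ.functor.mapAut 𝔉.BN (ρ 𝔉.BN hB x : Aut 𝔉.BN) : Aut (Ψ.functor.obj 𝔉.BN)) =
        ρ (Ψ.functor.obj 𝔉.BN) hΨB (aΨ 𝔉.BN x)) :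
    FrobenioidCyclotomicRigidity.CyclotomicRigidityPreserved 𝔉 Ψ ρ aΨ :=
  cyclotomicRigidityPreserved_of_model' Ψ h𝔉 h hD hnd hN (baseEquivalent_map_of_model h𝔉 h hD hslim hnd hN Ψ)
    (baseEquivalent_map_of_model h𝔉 h hD hslim hnd hN Ψ.symm) aΨ ρ hB hreach hρ haΨ hpull hBN

end Slim

end ThetaFrobenioid

end Literature.AnabelianGeometry.EtaleTheta
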